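import Summits.RiemannHypothesis.RiemannHypothesis.Theorems.OddSectorOddOneSignedWindowsRenorm
import Summits.RiemannHypothesis.RiemannHypothesis.Theorems.OddSectorOddOneSignedWindowsEulerLagrangeTransfer
import Summits.RiemannHypothesis.RiemannHypothesis.Theorems.OddSectorOddNegativityOffLine
import Literature.NumberTheory.LFunctions.WeilMarkovQuadratic
import HarnessLib

/-!
# Crux-strategist sketch — `OddSector.OddOneSignedWindows` (item stmt-RiemannHypothesis-17778)

Typed companion of `STRATEGY-CENSUS.md` (strategist seat
`planner-cstrat-stmt-RiemannHypothesis-17778-s2-0`, 2026-08-17). Every census heading has its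
signatures here; the file elaborates with `sorry` nowhere (the open statements are `def … : Prop`).

* TRANSFER (T1/T3): the FOLD CRITERION — the odd-sector version of the Beurling–Deny / Bañuelos–
  Kulczycki folding that PROVED the sibling `OddArchAnchor` (`Theorems/OddSectorOddArchAnchor*.lean`):
  folding `g ↦ sign · |g|` lowers the pole term, the archimedean energy and the DIRECT prime
  increments; the only unfavourable piece is the REFLECTED prime pairs `s + s' = log n` inside the
  window (`reflectedPairCost`). Because the crux is EXISTENTIAL in the ground state, folding gives
  the exact residue: a window is good iff some real odd ground state has vanishing reflected-pair
  cost (`oddOneSignedWindows_of_fold`, `noOpposedReflections_of_oddOneSignedWindows`): the residue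
  `NoOpposedReflections` is the crux REWORDED modulo the RH-free `FoldCriterion` — kernel-checked
  below (`residue_iff`). Small windows `2a < log 2` carry no atom, so the fold is free there
  (`reflectedPairCost_eq_zero_of_small`, `smallWindow_good_of_fold`): the in-kind anchor WITH the
  pole term.
* STRENGTHEN (S1/S3): `AllLargeWindowsGood` (false at `a = log q`, 2001 Thm 10.8 / hub numerics) and
  `AllGroundStatesOneSigned` (PF-type), each implying the crux trivially.
* NEGATION (N1): `¬RH → OddBartaFloor → ¬OddOneSignedWindows` (contrapositive of the route's
  `closes` with the PROVED `oddNegativityOffLine_proof`).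

References: 2001 archive route `odd-sector-eigenfunction-sign`, ATTEMPTS 2026-08-10 ("variational
negativity criterion": only the reflected primes penalise the fold — "packaging, not reach") and
Rem 11.20(3); Bañuelos–Kulczycki, J. Funct. Anal. 211 (2004) Thm 4.3; Bombieri 2000 §4.
-/

noncomputable section

set_option linter.dupNamespace false

open MeasureTheory Set Filter
open scoped Topology

namespace Summit.RiemannHypothesis.RiemannHypothesis.Cruxes.OddOneSignedWindows.Strategist

open Literature.NumberTheory.LFunctions
open Summit.RiemannHypothesis.RiemannHypothesis.Theorems.OddSector
open Summit.RiemannHypothesis.RiemannHypothesis.Theses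

/-! ## TRANSFER — the fold criterion (T1) -/

/-- **Reflected-pair cost** of a real function `v` on the window `(0, a)`:
`Σ_{n ∈ weilPrimeIndex a} Λ(n) n^{-1/2} ∫_{0<s<a, 0<log n−s<a} (v(s)·v(log n − s))⁻ ds`.
Up to the factor `4` this is exactly the amount by which folding `g ↦ sign·|g|` RAISES the prime
part `Σ Λ(n) n^{-1/2} D_{log n}(g)` of the Dirichlet energy of an odd window function: the pairs
`(x, x + log n)` straddling the origin are the reflected pairs `(s, log n − s)` of `(0, a)`, where
`(|g(s)| + |g(s')|)² − (g(s) + g(s'))² = 4 (g(s) g(s'))⁻`; every other piece of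
`Re Q = P + 𝓔_a − M_a‖·‖²` folds favourably (pole: `|∫|g| sinh| ≥ |∫ g sinh|`; archimedean:
`setIntegral_weilArchDensity_mul_weilIncrement_fold_le`; direct pairs: Markov). -/
def reflectedPairCost (a : ℝ) (v : ℝ → ℝ) : ℝ :=
  ∑ n ∈ weilPrimeIndex a, (ArithmeticFunction.vonMangoldt n : ℝ) / Real.sqrt n *
    ∫ s in Ioo (0 : ℝ) a,
      (Ioo (0 : ℝ) a).indicator (fun r : ℝ => max (-(v s * v r)) 0) (Real.log n - s)

/-- **FOLD CRITERION** (RH-free, M-sized; the transferred argument of `OddArchAnchor`): if some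
real odd-sector ground state at the window `a` has NO sign-opposed reflected pair (cost `0`), then
the window is good — its fold `sign·|u|` is again an odd-sector ground state (fold the approximating
sequence with `exists_smooth_fold`; energies rise by at most the cost `→ 0`; renormalise with
`isWeilOddGroundState_of_defect_tendsto_zero`; the limit is one-signed by `ae_sign_of_tendsto`). -/
def FoldCriterion : Prop :=
  ∀ (a : ℝ) (u : ℝ → ℂ), IsWeilOddGroundState a u → (∀ t, (u t).im = 0) →
    reflectedPairCost a (fun t => (u t).re) = 0 →
    ∃ v : ℝ → ℂ, IsWeilOddGroundState a v ∧ ∀ᵐ t : ℝ, t ∈ Ioo 0 a → (v t).im = 0 ∧ 0 ≤ (v t).re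

/-- **The residue of the transfer**: beyond every height some window carries a real odd-sector
ground state without sign-opposed reflected pairs. RH-strength; `residue_iff` shows it is the crux
reworded modulo `FoldCriterion`. -/
def NoOpposedReflections : Prop :=
  ∀ A : ℝ, ∃ a : ℝ, A ≤ a ∧ ∃ u : ℝ → ℂ, IsWeilOddGroundState a u ∧ (∀ t, (u t).im = 0) ∧
    reflectedPairCost a (fun t => (u t).re) = 0

/-- The typed split `FoldCriterion → NoOpposedReflections → OddOneSignedWindows` (kernel-checked
glue; concludes the crux BY NAME). -/
theorem oddOneSignedWindows_of_fold (h₁ : FoldCriterion) (h₂ : NoOpposedReflections) :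
    OddSector.OddOneSignedWindows := by
  rw [oddOneSignedWindows_iff]
  intro A
  obtain ⟨a, hAa, u, hu, hreal, hcost⟩ := h₂ A
  obtain ⟨v, hv, hsign⟩ := h₁ a u hu hreal hcost
  exact ⟨a, hAa, v, hv, hsign⟩

/-- A function that is `≥ 0` a.e. on `(0, a)` has no sign-opposed reflected pair (the reflection
`s ↦ log n − s` preserves Lebesgue measure). [folklore] -/
theorem reflectedPairCost_eq_zero_of_ae_nonneg {a : ℝ} {v : ℝ → ℝ}
    (hv : ∀ᵐ t : ℝ, t ∈ Ioo 0 a → 0 ≤ v t) : reflectedPairCost a v = 0 := by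
  unfold reflectedPairCost
  refine Finset.sum_eq_zero fun n _ => ?_
  suffices h : ∫ s in Ioo (0 : ℝ) a,
      (Ioo (0 : ℝ) a).indicator (fun r : ℝ => max (-(v s * v r)) 0) (Real.log n - s) = 0 by
    rw [h, mul_zero]
  have hrefl : ∀ᵐ s : ℝ, (Real.log n - s) ∈ Ioo 0 a → 0 ≤ v (Real.log n - s) :=
    (Measure.measurePreserving_sub_left (volume : Measure ℝ)
      (Real.log n)).quasiMeasurePreserving.tendsto_ae.eventually hv
  refine setIntegral_eq_zero_of_ae_eq_zero ?_
  filter_upwards [hv, hrefl] with s h1 h2 hs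
  by_cases hr : Real.log n - s ∈ Ioo 0 a
  · rw [Set.indicator_of_mem hr]
    have h0 : 0 ≤ v s * v (Real.log n - s) := mul_nonneg (h1 hs) (h2 hr)
    exact max_eq_right (by linarith)
  · exact Set.indicator_of_notMem hr _

/-- **Converse (RH-free, proved)**: a good window has a real odd ground state with zero cost. -/
theorem noOpposedReflections_of_oddOneSignedWindows (h : OddSector.OddOneSignedWindows) :
    NoOpposedReflections := by
  rw [oddOneSignedWindows_iff_real_nonneg] at h
  intro A
  obtain ⟨a, hAa, v, hv, hreal, hsign⟩ := h A
  exact ⟨a, hAa, v, hv, hreal, reflectedPairCost_eq_zero_of_ae_nonneg hsign⟩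

/-- **The residue IS the crux** modulo the RH-free fold criterion: the transfer isolates the
obstruction (reflected atoms) exactly and moves none of the difficulty. -/
theorem residue_iff (h₁ : FoldCriterion) :
    NoOpposedReflections ↔ OddSector.OddOneSignedWindows :=
  ⟨oddOneSignedWindows_of_fold h₁, noOpposedReflections_of_oddOneSignedWindows⟩

/-! ## TRANSFER — the atom-free anchor with the pole term (T3) -/

/-- Below `a = ½ log 2` no prime power enters the window: `weilPrimeIndex a ⊆ {0, 1}`. -/
theorem weilPrimeIndex_subset_of_small {a : ℝ} (h : 2 * a < Real.log 2) :
    weilPrimeIndex a ⊆ {0, 1} := by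
  intro n hn
  unfold weilPrimeIndex at hn
  rw [Finset.mem_filter, Finset.mem_range] at hn
  have hexp : Real.exp (2 * a) < 2 := by
    calc Real.exp (2 * a) < Real.exp (Real.log 2) := Real.exp_lt_exp.2 h
      _ = 2 := Real.exp_log (by norm_num)
  have hfloor : ⌊Real.exp (2 * a)⌋₊ < 2 :=
    (Nat.floor_lt (Real.exp_pos _).le).2 (by exact_mod_cast hexp)
  have hn1 : n ≤ 1 := by omega
  interval_cases n <;> simp

/-- Hence the reflected-pair cost vanishes identically on small windows. -/
theorem reflectedPairCost_eq_zero_of_small {a : ℝ} (h : 2 * a < Real.log 2) (v : ℝ → ℝ) :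
    reflectedPairCost a v = 0 := by
  unfold reflectedPairCost
  refine Finset.sum_eq_zero fun n hn => ?_
  have hn' := weilPrimeIndex_subset_of_small h hn
  simp only [Finset.mem_insert, Finset.mem_singleton] at hn'
  rcases hn' with rfl | rfl <;> simp

/-- **Small-window anchor WITH the pole** (T3): granted the fold criterion, every window
`0 < a < ½ log 2` is good (a real odd ground state exists by `exists_isWeilOddGroundState_real`,
and its cost is `0`). The continuation upward in `a` dies at the first resonance `a = log 2`
(origin cusp) — see the census. -/
theorem smallWindow_good_of_fold (hF : FoldCriterion) {a : ℝ} (ha : 0 < a)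
    (h : 2 * a < Real.log 2) :
    ∃ v : ℝ → ℂ, IsWeilOddGroundState a v ∧
      ∀ᵐ t : ℝ, t ∈ Ioo 0 a → (v t).im = 0 ∧ 0 ≤ (v t).re := by
  obtain ⟨u, hu, hreal⟩ := exists_isWeilOddGroundState_real ha
  exact hF a u hu hreal (reflectedPairCost_eq_zero_of_small h _)

/-! ## STRENGTHEN — the two natural S⁺ (S1, S3) -/

/-- S1: ALL large windows are good. FALSE (a = log q: 2001 Thm 10.2/10.8; hub graded-mesh numerics
at `a = log 2`, item evidence assessment-17778 v2) — recorded as the refuted strengthening. -/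
def AllLargeWindowsGood : Prop :=
  ∃ a₀ : ℝ, ∀ a : ℝ, a₀ ≤ a → ∃ u : ℝ → ℂ, IsWeilOddGroundState a u ∧
    ∀ᵐ t : ℝ, t ∈ Ioo 0 a → (u t).im = 0 ∧ 0 ≤ (u t).re

theorem oddOneSignedWindows_of_allLarge (h : AllLargeWindowsGood) :
    OddSector.OddOneSignedWindows := by
  rw [oddOneSignedWindows_iff]
  obtain ⟨a₀, ha₀⟩ := h
  intro A
  obtain ⟨u, hu, hsign⟩ := ha₀ (max A a₀) (le_max_right _ _)
  exact ⟨max A a₀, le_max_left _ _, u, hu, hsign⟩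

/-- S3 (Perron–Frobenius shape): on unboundedly many windows EVERY real odd ground state is
one-signed on `(0, a)`. Stronger than the crux (which is existential); its natural proof
(positivity-improving semigroup) breaks at the reflected atoms exactly as the fold does, and the
rigidity it adds (uniqueness up to sign) is itself RH-strength i.o. (odd pinning / BN1). -/
def AllGroundStatesOneSigned : Prop :=
  ∀ A : ℝ, ∃ a : ℝ, A ≤ a ∧ 0 < a ∧ ∀ u : ℝ → ℂ, IsWeilOddGroundState a u → (∀ t, (u t).im = 0) →
    (∀ᵐ t : ℝ, t ∈ Ioo 0 a → 0 ≤ (u t).re) ∨ (∀ᵐ t : ℝ, t ∈ Ioo 0 a → (u t).re ≤ 0)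

theorem oddOneSignedWindows_of_allGroundStates (h : AllGroundStatesOneSigned) :
    OddSector.OddOneSignedWindows := by
  refine oddOneSignedWindows_of_real_oneSigned fun A => ?_
  obtain ⟨a, hAa, ha, hall⟩ := h A
  obtain ⟨v, hv, hreal⟩ := exists_isWeilOddGroundState_real ha
  exact ⟨a, hAa, v, hv, hreal, hall v hv hreal⟩

/-! ## NEGATION — ¬S is exactly as hard as ¬RH from the route's side (N1) -/

/-- If RH fails, no large window is good, GIVEN the RH-free odd Barta floor (crux
`OddBartaFloor`, item 17779): contrapositive of the route's deciding theorem `closes` with the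
PROVED `OddNegativityOffLine` (`Theorems.oddNegativityOffLine_proof`). So an unconditional
counterexample to the crux would (with the Barta floor) be worth exactly `¬RH`-type input. -/
theorem not_oddOneSignedWindows_of_not_RH (hBarta : OddSector.OddBartaFloor)
    (hRH : ¬ _root_.Summit.RiemannHypothesis) : ¬ OddSector.OddOneSignedWindows :=
  fun hS => hRH (OddSector.closes hBarta hS
    Summit.RiemannHypothesis.RiemannHypothesis.Theorems.oddNegativityOffLine_proof)

end Summit.RiemannHypothesis.RiemannHypothesis.Cruxes.OddOneSignedWindows.Strategist
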